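import Literature.MathematicalPhysics.QuantumFieldTheory.Balaban1983to89.B9Eq342GradientRowCubeLetters

/-!
# `Balaban1983to89.B9Eq342GradientRowSmallGaugeLetters` — T. Bałaban, *Propagators for lattice gauge theories in a background field*, Commun. Math. Phys.
# **99** (1985) 389–434 [Balaban1985BackgroundPropagators] (3.35) p. 396 (the regularity class: «there exists a gauge transformation u on □ such that
# U^u = e^{iηA}, and … |A| < O(1)Mα₀(L^jη)⁻¹, |∇^ηA| < O(1)Mα₀(L^jη)⁻²»), (3.28)–(3.31) p. 395, (3.43) p. 398 (the localising functions), (3.70)–(3.73)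
# pp. 404–405: **STOREY J's CENTRE-INDEPENDENT LETTERS IN A GLOBAL SMALL GAUGE — if the background is small on EVERY bond (`U(b) ∈ U1`, `‖U(b) − 1‖ ≤ ε_U`:
# the MODEL letter `hUε` of the NE9 OWNER's `B9Eq326LocalPartBlockDecayClosed` ∕ `B9Eq326LocalPartPointRow`), then the comparison gauge of
# `B9Eq342GradientRowAssembly` §3∕§5 can be taken TRIVIAL at every output bond (`g_{b₀} ≡ 1`, pure-gauge skeleton `U⁰ = 1^1 = 1`), the localising family
# TRIVIAL (`χ_{b₀} ≡ 1`, `Ω_{b₀}` = everything, `c∕r = c∕r² = 0`), and the four fibre letters hold on the WHOLE lattice: `δ = b = 2M_φM_φ′ε_U`, and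
# `b′ = 2M_φM_φ′·a_U` from the bond-gradient datum `‖U(x,μ) − U(x−e_μ,μ)‖ ≤ a_U` (or `b′ = 2M_φM_φ′·η(ηa′)e^{ηr}` in the gauge `U = e^{iηA}`)** — this
# lineage's (K50) `B9Eq342GradientRowCubeLetters` at `g := 1`, `V := U`, `p := ⊤` (`U = gaugeU 1 U` is `B9Eq328GaugeAction.gaugeU_one`); no cube, no margin,
# no cutoff is needed in the cell's model, and the t-freeness bookkeeping of (3.35) reads `|t|·b = 2M_φM_φ′·(L·ε_U)`, `t²·b′ = 2M_φM_φ′·(L²·a_U)` at `t = η⁻¹ = L`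
# (successor memo `t4/b2b-balaban-t4-ne9-formalise-leaf-05/g85/STOREY-J-A0-MAP-g85.md` §3 (c)–(e))

statement-level skeleton of published theorems with citation tags; proofs where landed; nothing here is a claim about the Yang–Mills mass gap

CITATION HEADER (lean-in-tree rule).  Audit cell `pub-balaban`, sub-cell `t4`, BINDER row NE9; filed by NE9 crux-team LEAF PROVER 05
(`b2b-balaban-t4-ne9-formalise-leaf-05`, gen 86).  Imports this lineage's (K50) `B9Eq342GradientRowCubeLetters` (p392604; through it (K30)
`B9Eq331PureGaugeResolventConjugation` §5∕§6, (K31) `B9Eq373TransporterLipschitzLetters`, `B9Eq384RemainderLetters` §4, `B9Eq328GaugeAction`).  SOURCE READ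
first-hand in the held text layer [Balaban1985BackgroundPropagators] (`paper:balaban1985-cmp99-background-propagators`): p. 396 (3.35); p. 395 (3.28)–(3.31);
p. 398 (3.43)–(3.46); pp. 404–405 (3.70)–(3.73).  Print localises to the cubes of the class (3.35) because `A` is small only cube by cube; the cell's model for
the local part `A₀` (the OWNER's (D0-d) CLOSED) is a background small on every bond, where the localisation is the identity — [folklore] instantiation BY NAME;
nothing printed is a hypothesis except the smallness data themselves (`ε_U`, `a_U` ∕ `a′` — the consumer's); the `[cite: …]` tags are TEXT LOCATIONS.

WHAT IS PROVED (sorry-free; 0 `def`; [folklore]).  Context: `φ : W ≃ₗ[ℂ] 𝔸`, `‖φw‖ ≤ M_φ‖w‖`, `‖φ⁻¹X‖ ≤ M_φ′‖X‖`, `0 ≤ M_φ′`; the background `U` with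
`U(b) ∈ U1` and `‖U(b) − 1‖ ≤ ε_U` on every bond.  Notation of the statements: `R_U = adTransportW φ U`, `S_U = adTransportW φ U⁻¹`,
`R⁰ = adTransportW φ (gaugeU 1 1)` (the pure-gauge skeleton of the trivial gauge, `= 1` by §1), `S⁰` its inverse field.
* §1 **`AdW_one`**, **`inner_AdW_one`** (`Ad(1) = 1` — the `hAd`∕`hAdf` binder of the trivial gauge), **`eq_gaugeU_one`** (`U(b) = (gaugeU 1 U)(b)` — the
  `hagree` binder on `p = ⊤`), **`adTransportW_skeleton_apply`**, **`adTransportW_skeleton_inv_apply`** (`R⁰(b)w = w`, `S⁰(b)w = w`).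
* §2 on every bond: **`norm_sub_pureGauge_le`** (`‖R_U(b)w − R⁰(b)w‖ ≤ 2M_φM_φ′ε_U‖w‖` — `hδ`), **`norm_rel_sub_le`** (`‖R⁰(b)(S_U(b)w) − w‖ ≤ 2M_φM_φ′ε_U‖w‖`
  — `hBp`∕`hBm`), **`norm_inv_sub_le`** (`‖S⁰(b)w − S_U(b)w‖ ≤ 2M_φM_φ′ε_U‖w‖` — `hBt`), **`norm_covDiff_le_of_sub`** (the `hD` expression at `x, μ` is
  `≤ 2M_φM_φ′·‖U(x,μ) − U(x−e_μ,μ)‖·‖w‖`), **`norm_covDiff_le`** (`≤ 2M_φM_φ′a_U‖w‖` from the bond-gradient datum `a_U`), **`norm_covDiff_le_exp`** (`U = e^{iηA}`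
  as group elements on every bond, `η ≥ 0`, `‖A‖ ≤ r`, `‖A(x,μ) − A(x−e_μ,μ)‖ ≤ ηa′`: `≤ 2M_φM_φ′·(η(ηa′)e^{ηr})·‖w‖`).
* §3 **`small_gauge_letters`** — packaging in `B9Eq342GradientRowAssembly` §3∕§4∕§5's literal shapes on `Ω = Set.univ`: the conjunction `hBp ∧ hBm ∧ hBt ∧ hD`
  (`b = 2M_φM_φ′ε_U`, `b′ = 2M_φM_φ′a_U`); **`trivial_cutoff_letters`** — the constant family `χ ≡ 1` has `|χ| ≤ 1`, `χ = 1` at both ends of every bond, first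
  and second difference letters `0`, and the support condition on `Set.univ` is vacuous.
HONEST SCOPE.  Instantiation and naming only; `ε_U = O(η|A|)` and `a_U = O(η²|∇^ηA|)` are the (3.35)-type HYPOTHESES (the cell's model letters), not derived;
whether a given background admits a GLOBAL small gauge is the model's matter (print's class (3.35) is cube-local; the cell's rows are «WALLED ON A MODEL»);
nothing of [B9] Thm 3.1∕3.3∕3.11 is asserted, valued or discharged.  NOT NE9 (cell pub-balaban: NE9 NOT PRINTED ∕ NOT PROVED; «NE9 ⇐ the named binders»; row
WALLED ON A MODEL (O-NE9-1; #5 UNRULED); spine PROVED 0∕9; rung (B)+1 on a finite T⁴ — NOT infinite volume, NOT mass gap, NOT Clay; HONEST DEPENDENCY: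
continuum YM on T⁴ ⇐ BetaPertH ∧ nine spine estimates (0/9 proved); BetaPertH ⇐ (D1) ∧ (D4) ∧ CAP+tail; G-an2-4 gates asym, D1 and NE2/3/4).  NEW file; nothing
modified.  Net new unproved facts: 0.
-/

noncomputable section

set_option autoImplicit false

open scoped InnerProductSpace

namespace Literature.MathematicalPhysics.QuantumFieldTheory.Balaban1983to89.B9Eq342GradientRowSmallGaugeLetters

open B4Sect5Torus (TSite)
open B9SectCLatticeCarrier (Bond bpos btgt shift unshift)
open B9Eq310HessianOperator (adTransportW)
open B9Eq328GaugeAction (gaugeU AdW AdW_apply gaugeU_one adTransportW_eq_AdW)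
open B7Prop1Explicit (U1)
open B9Eq342GradientRowCubeLetters (norm_sub_pureGauge_le_on norm_rel_sub_le_on norm_inv_sub_le_on norm_covDiff_le_on_of_sub
  norm_covDiff_le_on_exp cube_letters)

variable {d : ℕ} {Pd : Fin d → ℕ} {𝔸 : Type*} [NormedRing 𝔸] [NormedAlgebra ℂ 𝔸] [NormOneClass 𝔸]
  {W : Type*} [NormedAddCommGroup W] [InnerProductSpace ℂ W] (φ : W ≃ₗ[ℂ] 𝔸) {Mφ Mφ' : ℝ}
  (hφ : ∀ w, ‖φ w‖ ≤ Mφ * ‖w‖) (hφ' : ∀ X, ‖φ.symm X‖ ≤ Mφ' * ‖X‖) (hMφ : 0 ≤ Mφ) (hMφ' : 0 ≤ Mφ')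
  (U : Bond d Pd → 𝔸ˣ) (hU1 : ∀ b, U b ∈ U1 𝔸) {εU : ℝ} (hUε : ∀ b, ‖(U b : 𝔸) - 1‖ ≤ εU)

/-! ## §1 The trivial comparison gauge `g ≡ 1`: `Ad(1) = 1`, `U = gaugeU 1 U`, and the pure-gauge skeleton `gaugeU 1 1` transports by the identity -/

omit [NormOneClass 𝔸] in
/-- `Ad(1)w = w` on the fibre. [folklore] [cite: Balaban1985BackgroundPropagators, (3.28) p.395] -/
theorem AdW_one (w : W) : AdW φ (1 : 𝔸ˣ) w = w := by
  rw [AdW_apply, Units.val_one, inv_one, Units.val_one, one_mul, mul_one, LinearEquiv.symm_apply_apply]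

omit [NormOneClass 𝔸] in
/-- **THE TRIVIAL GAUGE IS FIBREWISE ISOMETRIC** — the `hAd` binder of `B9Eq342GradientRowCubeLetters` ∕ the `hAdf` binder of `B9Eq342GradientRowAssembly` §3
at `g ≡ 1`. [folklore] [cite: Balaban1985BackgroundPropagators, (3.28)–(3.30) p.395] -/
theorem inner_AdW_one (x : TSite d Pd) (v v' : W) : ⟪AdW φ ((1 : TSite d Pd → 𝔸ˣ) x) v, AdW φ ((1 : TSite d Pd → 𝔸ˣ) x) v'⟫_ℂ = ⟪v, v'⟫_ℂ := by
  rw [Pi.one_apply, AdW_one, AdW_one]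

omit [NormedAlgebra ℂ 𝔸] [NormOneClass 𝔸] in
/-- **`U = U^{1}` ON EVERY BOND** — the `hagree` binder of `B9Eq342GradientRowCubeLetters` at `g ≡ 1`, `V := U`, `p := ⊤` (`B9Eq328GaugeAction.gaugeU_one`).
[folklore] [cite: Balaban1985BackgroundPropagators, (3.28) p.395] -/
theorem eq_gaugeU_one : ∀ b : Bond d Pd, True → U b = gaugeU (1 : TSite d Pd → 𝔸ˣ) U b := fun b _ => by
  rw [gaugeU_one]

omit [NormOneClass 𝔸] in
/-- the pure-gauge skeleton of the trivial gauge transports by the identity: `R⁰(b)w = w`. [folklore] [cite: Balaban1985BackgroundPropagators, (3.28)–(3.31) p.395] -/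
theorem adTransportW_skeleton_apply (b : Bond d Pd) (w : W) : adTransportW φ (gaugeU (1 : TSite d Pd → 𝔸ˣ) 1) b w = w := by
  rw [gaugeU_one, adTransportW_eq_AdW, Pi.one_apply, AdW_one]

omit [NormOneClass 𝔸] in
/-- … and so does its inverse field: `S⁰(b)w = w`. [folklore] [cite: Balaban1985BackgroundPropagators, (3.8) p.392, (3.28) p.395] -/
theorem adTransportW_skeleton_inv_apply (b : Bond d Pd) (w : W) :
    adTransportW φ (fun bb => (gaugeU (1 : TSite d Pd → 𝔸ˣ) 1 bb)⁻¹) b w = w := by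
  rw [adTransportW_eq_AdW, gaugeU_one, Pi.one_apply, inv_one, AdW_one]

/-! ## §2 The four fibre letters on every bond -/

include hφ hφ' hMφ' hU1 hUε in
/-- **`hδ` EVERYWHERE**: `‖R(U(b))w − R⁰(b)w‖ ≤ 2M_φM_φ′ε_U‖w‖`. [folklore] [cite: Balaban1985BackgroundPropagators, (3.35) p.396, (3.70) p.404, (3.28)–(3.30) p.395] -/
theorem norm_sub_pureGauge_le (b : Bond d Pd) (w : W) :
    ‖adTransportW φ U b w - adTransportW φ (gaugeU (1 : TSite d Pd → 𝔸ˣ) 1) b w‖ ≤ 2 * Mφ * Mφ' * εU * ‖w‖ :=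
  norm_sub_pureGauge_le_on φ hφ hφ' hMφ' 1 (inner_AdW_one φ) U hU1 U (fun _ => True) (eq_gaugeU_one U) (fun b _ => hUε b) b trivial w

include hφ hφ' hMφ' hU1 hUε in
/-- **`hBp`∕`hBm` EVERYWHERE**: `‖R⁰(b)(R(U(b)⁻¹)w) − w‖ ≤ 2M_φM_φ′ε_U‖w‖`. [folklore] [cite: Balaban1985BackgroundPropagators, (3.35) p.396, (3.70) p.404, (3.73) p.405] -/
theorem norm_rel_sub_le (b : Bond d Pd) (w : W) :
    ‖adTransportW φ (gaugeU (1 : TSite d Pd → 𝔸ˣ) 1) b (adTransportW φ (fun bb => (U bb)⁻¹) b w) - w‖ ≤ 2 * Mφ * Mφ' * εU * ‖w‖ :=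
  norm_rel_sub_le_on φ hφ hφ' hMφ' 1 (inner_AdW_one φ) U hU1 U (fun _ => True) (eq_gaugeU_one U) (fun b _ => hUε b) b trivial w

include hφ hφ' hMφ' hU1 hUε in
/-- **`hBt` EVERYWHERE**: `‖S⁰(b)w − R(U(b)⁻¹)w‖ ≤ 2M_φM_φ′ε_U‖w‖`. [folklore] [cite: Balaban1985BackgroundPropagators, (3.35) p.396, (3.70) p.404, (3.8) p.392] -/
theorem norm_inv_sub_le (b : Bond d Pd) (w : W) :
    ‖adTransportW φ (fun bb => (gaugeU (1 : TSite d Pd → 𝔸ˣ) 1 bb)⁻¹) b w - adTransportW φ (fun bb => (U bb)⁻¹) b w‖ ≤ 2 * Mφ * Mφ' * εU * ‖w‖ :=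
  norm_inv_sub_le_on φ hφ hφ' hMφ' 1 (inner_AdW_one φ) U hU1 U (fun _ => True) (eq_gaugeU_one U) (fun b _ => hUε b) b trivial w

include hφ hφ' hMφ' hU1 in
/-- **`hD` EVERYWHERE FROM THE BOND-VARIABLE DIFFERENCE**: the `U⁰`-covariant difference of the relative transporter along `μ` at `x` is
`≤ 2M_φM_φ′·‖U(x,μ) − U(x−e_μ,μ)‖·‖w‖`. [folklore] [cite: Balaban1985BackgroundPropagators, (3.73) p.405, (3.70) p.404] -/
theorem norm_covDiff_le_of_sub (x : TSite d Pd) (μ : Fin d) (w : W) :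
    ‖(adTransportW φ (gaugeU (1 : TSite d Pd → 𝔸ˣ) 1) (x, μ) (adTransportW φ (fun bb => (U bb)⁻¹) (x, μ) w) - w) -
      adTransportW φ (fun bb => (gaugeU (1 : TSite d Pd → 𝔸ˣ) 1 bb)⁻¹) (unshift μ x, μ)
        (adTransportW φ (gaugeU (1 : TSite d Pd → 𝔸ˣ) 1) (unshift μ x, μ) (adTransportW φ (fun bb => (U bb)⁻¹) (unshift μ x, μ)
          (adTransportW φ (gaugeU (1 : TSite d Pd → 𝔸ˣ) 1) (unshift μ x, μ) w)) - adTransportW φ (gaugeU (1 : TSite d Pd → 𝔸ˣ) 1) (unshift μ x, μ) w)‖ ≤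
      2 * Mφ * Mφ' * ‖(U (x, μ) : 𝔸) - (U (unshift μ x, μ) : 𝔸)‖ * ‖w‖ :=
  norm_covDiff_le_on_of_sub φ hφ hφ' hMφ' 1 (inner_AdW_one φ) U hU1 U (fun _ => True) (eq_gaugeU_one U) x μ trivial trivial w

include hφ hφ' hMφ hMφ' hU1 in
/-- **`hD` EVERYWHERE FROM THE BOND-GRADIENT DATUM `a_U`**: `‖U(x,μ) − U(x−e_μ,μ)‖ ≤ a_U` for all `x, μ` ⟹ the covariant difference is `≤ 2M_φM_φ′a_U‖w‖`
(`t²·b′ = 2M_φM_φ′·(t²a_U)`: t-free exactly when `a_U = O(η²)`, print's `η²|∇^ηA|`). [folklore] [cite: Balaban1985BackgroundPropagators, (3.73) p.405, (3.35) p.396] -/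
theorem norm_covDiff_le {aU : ℝ} (hUa : ∀ (x : TSite d Pd) (μ : Fin d), ‖(U (x, μ) : 𝔸) - (U (unshift μ x, μ) : 𝔸)‖ ≤ aU)
    (x : TSite d Pd) (μ : Fin d) (w : W) :
    ‖(adTransportW φ (gaugeU (1 : TSite d Pd → 𝔸ˣ) 1) (x, μ) (adTransportW φ (fun bb => (U bb)⁻¹) (x, μ) w) - w) -
      adTransportW φ (fun bb => (gaugeU (1 : TSite d Pd → 𝔸ˣ) 1 bb)⁻¹) (unshift μ x, μ)
        (adTransportW φ (gaugeU (1 : TSite d Pd → 𝔸ˣ) 1) (unshift μ x, μ) (adTransportW φ (fun bb => (U bb)⁻¹) (unshift μ x, μ)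
          (adTransportW φ (gaugeU (1 : TSite d Pd → 𝔸ˣ) 1) (unshift μ x, μ) w)) - adTransportW φ (gaugeU (1 : TSite d Pd → 𝔸ˣ) 1) (unshift μ x, μ) w)‖ ≤
      2 * Mφ * Mφ' * aU * ‖w‖ := by
  refine (norm_covDiff_le_of_sub φ hφ hφ' hMφ' U hU1 x μ w).trans ?_
  have hM : 0 ≤ 2 * Mφ * Mφ' := by positivity
  exact mul_le_mul_of_nonneg_right (mul_le_mul_of_nonneg_left (hUa x μ) hM) (norm_nonneg w)

include hφ hφ' hMφ hMφ' hU1 in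
/-- **`hD` EVERYWHERE IN THE GAUGE `U = e^{iηA}`**: `η ≥ 0`, `‖A‖ ≤ r` and `‖A(x,μ) − A(x−e_μ,μ)‖ ≤ ηa′` on every bond ⟹ `≤ 2M_φM_φ′·(η(ηa′)e^{ηr})·‖w‖`.
[folklore] [cite: Balaban1985BackgroundPropagators, (3.73) p.405, (3.35) p.396] -/
theorem norm_covDiff_le_exp [CompleteSpace 𝔸] {η r a' : ℝ} (hη : 0 ≤ η) (A : Bond d Pd → 𝔸)
    (hUA : ∀ b, (U b : 𝔸) = NormedSpace.exp ((Complex.I * η : ℂ) • A b)) (hA : ∀ b, ‖A b‖ ≤ r)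
    (hdA : ∀ (x : TSite d Pd) (μ : Fin d), ‖A (x, μ) - A (unshift μ x, μ)‖ ≤ η * a') (x : TSite d Pd) (μ : Fin d) (w : W) :
    ‖(adTransportW φ (gaugeU (1 : TSite d Pd → 𝔸ˣ) 1) (x, μ) (adTransportW φ (fun bb => (U bb)⁻¹) (x, μ) w) - w) -
      adTransportW φ (fun bb => (gaugeU (1 : TSite d Pd → 𝔸ˣ) 1 bb)⁻¹) (unshift μ x, μ)
        (adTransportW φ (gaugeU (1 : TSite d Pd → 𝔸ˣ) 1) (unshift μ x, μ) (adTransportW φ (fun bb => (U bb)⁻¹) (unshift μ x, μ)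
          (adTransportW φ (gaugeU (1 : TSite d Pd → 𝔸ˣ) 1) (unshift μ x, μ) w)) - adTransportW φ (gaugeU (1 : TSite d Pd → 𝔸ˣ) 1) (unshift μ x, μ) w)‖ ≤
      2 * Mφ * Mφ' * (η * (η * a') * Real.exp (η * r)) * ‖w‖ :=
  norm_covDiff_le_on_exp φ hφ hφ' hMφ hMφ' 1 (inner_AdW_one φ) U hU1 U (fun _ => True) (eq_gaugeU_one U) x μ trivial trivial hη A (hUA _) (hUA _)
    (hA _) (hA _) (hdA x μ) w

/-! ## §3 Packaging in `B9Eq342GradientRowAssembly`'s literal shapes: the fibre letters on `Set.univ`, and the trivial localising family -/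

include hφ hφ' hMφ hMφ' hU1 hUε in
/-- **THE SMALL-GAUGE LETTERS IN THE ASSEMBLY's SHAPES** (`Ω = Set.univ`, `g ≡ 1`): the conjunction of `hBp`, `hBm`, `hBt` (`b = 2M_φM_φ′ε_U`) and `hD`
(`b′ = 2M_φM_φ′a_U`) of `B9Eq342GradientRowAssembly.norm_covDeriv_le_weighted_of_letters(_uniform∕_penalty)` at `R = R_U`, `S = S_U`, `R⁰ = R(gaugeU 1 1)`, `S⁰`.
[folklore] [cite: Balaban1985BackgroundPropagators, (3.35) p.396, (3.43) p.398, (3.70)–(3.73) pp.404–405] -/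
theorem small_gauge_letters {aU : ℝ} (hUa : ∀ (x : TSite d Pd) (μ : Fin d), ‖(U (x, μ) : 𝔸) - (U (unshift μ x, μ) : 𝔸)‖ ≤ aU) :
    (∀ x ∈ (Set.univ : Set (TSite d Pd)), ∀ (μ : Fin d) (w : W),
        ‖adTransportW φ (gaugeU (1 : TSite d Pd → 𝔸ˣ) 1) (x, μ) (adTransportW φ (fun bb => (U bb)⁻¹) (x, μ) w) - w‖ ≤ 2 * Mφ * Mφ' * εU * ‖w‖) ∧
      (∀ x ∈ (Set.univ : Set (TSite d Pd)), ∀ (μ : Fin d) (w : W),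
        ‖adTransportW φ (gaugeU (1 : TSite d Pd → 𝔸ˣ) 1) (unshift μ x, μ) (adTransportW φ (fun bb => (U bb)⁻¹) (unshift μ x, μ) w) - w‖ ≤
          2 * Mφ * Mφ' * εU * ‖w‖) ∧
      (∀ x ∈ (Set.univ : Set (TSite d Pd)), ∀ (μ : Fin d) (w : W),
        ‖adTransportW φ (fun bb => (gaugeU (1 : TSite d Pd → 𝔸ˣ) 1 bb)⁻¹) (unshift μ x, μ) w - adTransportW φ (fun bb => (U bb)⁻¹) (unshift μ x, μ) w‖ ≤
          2 * Mφ * Mφ' * εU * ‖w‖) ∧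
      (∀ x ∈ (Set.univ : Set (TSite d Pd)), ∀ (μ : Fin d) (w : W),
        ‖(adTransportW φ (gaugeU (1 : TSite d Pd → 𝔸ˣ) 1) (x, μ) (adTransportW φ (fun bb => (U bb)⁻¹) (x, μ) w) - w) -
          adTransportW φ (fun bb => (gaugeU (1 : TSite d Pd → 𝔸ˣ) 1 bb)⁻¹) (unshift μ x, μ)
            (adTransportW φ (gaugeU (1 : TSite d Pd → 𝔸ˣ) 1) (unshift μ x, μ) (adTransportW φ (fun bb => (U bb)⁻¹) (unshift μ x, μ)
              (adTransportW φ (gaugeU (1 : TSite d Pd → 𝔸ˣ) 1) (unshift μ x, μ) w)) - adTransportW φ (gaugeU (1 : TSite d Pd → 𝔸ˣ) 1) (unshift μ x, μ) w)‖ ≤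
          2 * Mφ * Mφ' * aU * ‖w‖) :=
  ⟨fun x _ μ w => norm_rel_sub_le φ hφ hφ' hMφ' U hU1 hUε (x, μ) w, fun x _ μ w => norm_rel_sub_le φ hφ hφ' hMφ' U hU1 hUε (unshift μ x, μ) w,
    fun x _ μ w => norm_inv_sub_le φ hφ hφ' hMφ' U hU1 hUε (unshift μ x, μ) w, fun x _ μ w => norm_covDiff_le φ hφ hφ' hMφ hMφ' U hU1 hUa x μ w⟩

omit [NormOneClass 𝔸] in
/-- **THE TRIVIAL LOCALISING FAMILY `χ ≡ 1`** has every letter of `B9Eq342GradientRowAssembly` §3∕§5 with `c∕r = c∕r² = 0` and `Ω = Set.univ`: `|χ| ≤ 1`,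
`χ = 1` at `b₋` and `b₊`, vanishing first and second `t`-difference letters, and a vacuous support condition. [folklore]
[cite: Balaban1985BackgroundPropagators, (3.43)–(3.46) p.398] -/
theorem trivial_cutoff_letters (t : ℝ) :
    (∀ (b₀ : Bond d Pd) (y : TSite d Pd), |(fun (_ : Bond d Pd) (_ : TSite d Pd) => (1 : ℝ)) b₀ y| ≤ 1) ∧
      (∀ b₀ : Bond d Pd, (fun (_ : Bond d Pd) (_ : TSite d Pd) => (1 : ℝ)) b₀ (bpos b₀) = 1) ∧
      (∀ b₀ : Bond d Pd, (fun (_ : Bond d Pd) (_ : TSite d Pd) => (1 : ℝ)) b₀ (btgt b₀) = 1) ∧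
      (∀ (b₀ : Bond d Pd) (x : TSite d Pd) (μ : Fin d),
        |t * ((fun (_ : Bond d Pd) (_ : TSite d Pd) => (1 : ℝ)) b₀ (shift μ x) - (fun (_ : Bond d Pd) (_ : TSite d Pd) => (1 : ℝ)) b₀ x)| ≤ (0 : ℝ) / 1) ∧
      (∀ (b₀ : Bond d Pd) (x : TSite d Pd) (μ : Fin d),
        |t * ((fun (_ : Bond d Pd) (_ : TSite d Pd) => (1 : ℝ)) b₀ x - (fun (_ : Bond d Pd) (_ : TSite d Pd) => (1 : ℝ)) b₀ (unshift μ x))| ≤ (0 : ℝ) / 1) ∧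
      (∀ (b₀ : Bond d Pd) (x : TSite d Pd) (μ : Fin d),
        |t ^ 2 * (2 * (fun (_ : Bond d Pd) (_ : TSite d Pd) => (1 : ℝ)) b₀ x - (fun (_ : Bond d Pd) (_ : TSite d Pd) => (1 : ℝ)) b₀ (shift μ x) -
          (fun (_ : Bond d Pd) (_ : TSite d Pd) => (1 : ℝ)) b₀ (unshift μ x))| ≤ (0 : ℝ) / 1 ^ 2) ∧
      (∀ (b₀ : Bond d Pd) (x : TSite d Pd), x ∉ (fun _ : Bond d Pd => (Set.univ : Set (TSite d Pd))) b₀ →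
        (fun (_ : Bond d Pd) (_ : TSite d Pd) => (1 : ℝ)) b₀ x = 0 ∧ (∀ μ : Fin d, (fun (_ : Bond d Pd) (_ : TSite d Pd) => (1 : ℝ)) b₀ (shift μ x) = 0) ∧
          (∀ μ : Fin d, (fun (_ : Bond d Pd) (_ : TSite d Pd) => (1 : ℝ)) b₀ (unshift μ x) = 0)) := by
  refine ⟨fun _ _ => by simp, fun _ => rfl, fun _ => rfl, fun _ _ _ => by simp, fun _ _ _ => by simp, fun _ _ _ => by norm_num, fun _ x hx => ?_⟩
  exact absurd (Set.mem_univ x) hx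

end Literature.MathematicalPhysics.QuantumFieldTheory.Balaban1983to89.B9Eq342GradientRowSmallGaugeLetters

end
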